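import Mathlib
import Literature.NumberTheory.LFunctions.Zhang2022.Section10Lemma102Steps
import Literature.NumberTheory.LFunctions.Zhang2022.SkeletonEval97cL102Rel
import Literature.NumberTheory.LFunctions.Zhang2022.TypedSection10B
import Literature.NumberTheory.LFunctions.Zhang2022.Section10RangeToolkit
import HarnessLib

/-!
# Zhang (2022), §10 Lemma 10.2: the RELATIVE readings the printed proof delivers — the shift-0
# log-mean («Lemma 8.4 at `β_μ = 0`»), (10.8)–(10.10) relative, (10.11) `Π`-weighted, the shifted
# twin of p. 57 — typed statements (readings) + bookkeeping edges, no analytic proofs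

Topic `Literature/NumberTheory/LFunctions/Zhang2022` (Landau–Siegel audit tree; verdict-neutral).
Y. Zhang, *Discrete mean estimates and the Landau–Siegel zero*, arXiv:2211.02515v1 (2022)
[Zhang2022LandauSiegel], §10 Lemma 10.2 (pp. 55–56, tex L2789–L2868), the Remark and the «simple
modification» of p. 57 (tex L2883–L2891), §8 Lemma 8.4 (p. 47) — **an unrefereed manuscript under
adjudication: every `def … : Prop` below is a CLAIM OF THE MANUSCRIPT (in the reading named in its
docstring), STATED NOT ASSERTED.** Discharge lane ZHANG-L (WP10 typer), companion to the typed CLAIM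
nodes of `TypedSection10A` (`Typed.Sec10A.Eq108 … Eq1011`, `Skeleton.Lemma102`) and to the relative
form `Skeleton.Lemma102Rel` (`SkeletonEval97cL102Rel`, p417175).

WHY THESE READINGS. The cell's gap rows record that the printed contour argument for Lemma 10.2
(«moved in the same way as the proof of Lemma 8.1 … by Lemma 5.8 and 8.2», p. 56) delivers the
displays (10.8)–(10.10) only with the error multiplied by `R(d,r) = (∏_{q∣dr}(1 − q⁻¹)⁻¹)²` (row
G-d43-1, family of `Skeleton.Lemma84Rel`, G-d55-3/G-adj1-1), and the window bound (10.11) only in a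
`Π(d,r)`-weighted form (row G-d60-1, disposition D-G-d60-1 = TEAM A D-G-adj1-1 (ii); tree edge
`Typed.Sec10A.eq1011_mid_weak_of_step10u021` for the middle window). `Skeleton.Lemma102Rel` relativises
(10.8)–(10.10) but keeps (10.11) uniform. This file NAMES, over the skeleton's objects and without
restating any of them:

* `LogMean0Rel c′` — the shift-0 log-mean estimate («LEMMA A» of sz-d43): for `dr < PT⁻²`,
  `T ≤ x ≤ P`, `Σ_{n≤x} χ(n)ξ₀ⱼ(n;d,r)n⁻¹log(x/n) = L′(1,χ)Π(d,r)(1 + (β_{j+1}+β_{j+2})log x +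
  ½β_{j+1}β_{j+2}log²x) + O(𝓛⁻⁶R(d,r))` — VERBATIM the hypothesis `hA` of the tree theorems
  `Lemma102.eq108Rel_of_logMean / eq109Rel_of_logMean / eq1010Rel_of_logMean` (p417365), so that
  those theorems read `LogMean0Rel c′ → Eq108Rel c′` etc. (`eq108Rel_of_logMean0Rel` below);
* `LogMeanShortRel c′` — the SHORT-range companion (`1 ≤ x ≤ T`): `‖Σ_{n≤x} χ(n)ξ₀ⱼ(n;d,r)n⁻¹log(x/n)‖
  ≤ C𝓛²R(d,r)` — the `𝔳₂ⱼ`-analogue of the tree's `Lemma101.norm_riesz_short_le` («the short Riesz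
  means `X ≤ T` are `O(𝓛²)`», the input behind the window bound (10.5) of Lemma 10.1); this is the
  reading of «The proof of (10.11) is similar to that of (10.5)» (p. 56, tex L2853) — NOT displayed in
  print (row G-d60-1: the windows at `P^{0.5}`, `P^{0.504}` have no display); on an edge window the
  tent decomposition `Lemma102.frakv2_eq_logMeans` has exactly one SHORT mean (`X < T`), so
  `LogMean0Rel ∧ LogMeanShortRel ⇒ Eq1011RelW` is pure bookkeeping (left to the WP10 provers). The
  tree's uniform tail mean `XiZeroTailMean.xiZeroTailMean` (`Σ_{n<x}|ξ₀ⱼ|/n ≤ C𝓛(1 + log x)³`) gives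
  the short means only to size `≍ 𝓛^{5.4}` (resp. `𝓛^{4.4}` without the factor `𝓛`), i.e. a window
  exponent near `3.6`–`4.6` instead of the printed `7`;
* `Eq108Rel c′`, `Eq109Rel c′`, `Eq1010Rel c′` — (10.8)–(10.10) relative (VERBATIM the conclusions
  of those three theorems = clauses 1–3 of `Skeleton.Lemma102Rel`);
* `Eq1011RelW c′` — (10.11) on the three edge windows `Typed.Sec10A.edgeWindows` with the bound
  `C𝓛⁻⁷R(d,r)` (implied by the printed uniform form, `eq1011RelW_of_eq1011`, and by the
  `(1 + |Π(d,r)|)`-weighted form since `|Π(d,r)| ≤ R(d,r)`, `eq1011RelW_of_piWeighted`);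
* `Lemma102RelW c′` — Lemma 10.2 in the reading the printed proof delivers: `Skeleton.Lemma102Rel`
  VERBATIM except that clause 4 carries the factor `R(d,r)` too (`lemma102RelW_iff_eqs`,
  `lemma102RelW_of_lemma102Rel`, `lemma102RelW_of_lemma102`, and the ASSEMBLY
  `lemma102RelW_of_logMean0Rel : LogMean0Rel c′ → Eq1011RelW c′ → Lemma102RelW c′`);
* `Lemma102SRel c′` — the «simple modification» of p. 57 (shifted `f̃`, §10.u033) in the same
  relative reading: `Typed.Sec10B.Lemma102S` VERBATIM except for the factor `R(d,r)` in all four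
  clauses (`lemma102SRel_of_lemma102S`); consumer: the range claims `Typed.Sec10C.Low1214Eval /
  Mid1214Eval / Top1214Eval` of the evaluation of `S_j(𝐚₁₂,𝐚₁₄)` (p. 60–61);
* `Ded183RelW c′` — the §18 consumer node `Skeleton.Ded183` re-pointed to `Lemma102RelW`
  (`ded183Rel_of_ded183RelW`, `ded183_of_ded183RelW`).

The theorems here are bookkeeping only (monotonicity of the readings, splitting/merging of the
uniform constant); 0 analytic content, 0 new objects, 0 facts. WHAT THIS IS NOT: a proof of any of
these claims, a re-type of any skeleton leaf (that is the lead's/pen's/referee's call, HOME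
RETYPE-LEDGER), or anything about Theorems 1–2 of the source or Landau–Siegel zeros.

## References

* Y. Zhang, arXiv:2211.02515v1 (2022), §10 Lemma 10.2 pp. 55–57, §8 Lemma 8.4 p. 47, §18 p. 100.
  [cite: Zhang2022LandauSiegel, §10 Lemma 10.2]
-/

noncomputable section

open Complex Real

namespace Literature.NumberTheory.LFunctions.Zhang2022.Typed.Sec10Rel

open Literature.NumberTheory.LFunctions.Zhang2022
open Literature.NumberTheory.LFunctions.Zhang2022.Skeleton
open Literature.NumberTheory.LFunctions.Zhang2022.Typed.Sec10B (yShift frakv2S Lemma102S)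

/-! ## Statements (readings of Lemma 10.2 and of its proof) -/

section Statements

variable (c' : ℝ)

/-- **The shift-0 log-mean estimate** («Lemma 8.4 at `β_μ = 0`», relative form; «LEMMA A» of the
cell's §10 plan): for `dr < PT⁻²`, `T ≤ x ≤ P`, `1 ≤ j ≤ 3`,
`‖Σ_{n≤x} χ(n)ξ₀ⱼ(n;d,r)n⁻¹log(x/n) − L′(1,χ)Π(d,r)(1 + (β_{j+1}+β_{j+2})log x + ½β_{j+1}β_{j+2}log²x)‖
≤ C𝓛⁻⁶(∏_{q∣dr}(1 − q⁻¹)⁻¹)²` — what «the contour of integration is moved in the same way as the proof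
of Lemma 8.1. Thus, by Lemma 5.8 and 8.2, …» (p. 56, tex L2831–L2839) is read to deliver for the
kernel `(u+β_{j+1})(u+β_{j+2})/u³` (cf. `Skeleton.Lemma84Rel`, shifts `β_μ`, `μ = 6,7`). VERBATIM the
hypothesis `hA` of `Lemma102.eq108Rel_of_logMean`. CLAIM (reading), stated not asserted.
[cite: Zhang2022LandauSiegel, §10 Lemma 10.2 proof p.56; §8 Lemma 8.4 p.47] -/
def LogMean0Rel : Prop :=
  ∃ C : ℝ, ForAllLarge fun D _ χ => AssumptionA D χ → ∀ j ∈ ({1, 2, 3} : Finset ℕ), ∀ d r : ℕ,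
    1 ≤ d → 1 ≤ r → ((d * r : ℕ) : ℝ) < bigP D / bigT D ^ 2 → ∀ x : ℝ, bigT D ≤ x → x ≤ bigP D →
      ‖(∑ n ∈ Finset.Ioc 0 ⌊x⌋₊, χ (n : ZMod D) * xiZero c' D j n d r / (n : ℂ) *
            (Real.log (x / n) : ℂ)) -
          deriv χ.LFunction 1 * PiW χ d r *
            (1 + (betaJ c' D (j + 1) + betaJ c' D (j + 2)) * (Real.log x : ℂ) +
              betaJ c' D (j + 1) * betaJ c' D (j + 2) * (Real.log x : ℂ) ^ 2 / 2)‖ ≤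
        C * (ell D ^ 6)⁻¹ * (∏ q ∈ (d * r).primeFactors, (1 - (q : ℝ)⁻¹)⁻¹) ^ 2

/-- **The short-range log-mean bound** (reading of «The proof of (10.11) is similar to that of
(10.5)», p. 56 tex L2853 — the `𝔳₂ⱼ`-analogue of the `O(𝓛²)` short Riesz means behind (10.5), tree
`Lemma101.norm_riesz_short_le`): for `dr < PT⁻²`, `1 ≤ x ≤ T`, `1 ≤ j ≤ 3`,
`‖Σ_{n≤x} χ(n)ξ₀ⱼ(n;d,r)n⁻¹log(x/n)‖ ≤ C𝓛²(∏_{q∣dr}(1 − q⁻¹)⁻¹)²` (the size of the main term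
`L′(1,χ)Π(d,r)` at `x = T`, `|L′(1,χ)| ≪ 𝓛²`, `|Π(d,r)| ≤ R(d,r)`). NOT DISPLAYED IN PRINT (row
G-d60-1); together with `LogMean0Rel` it yields the window clause `Eq1011RelW` by the tent
decomposition. CLAIM (reading), stated not asserted. [cite: Zhang2022LandauSiegel, §10 Lemma 10.2 proof p.56, tex L2853] -/
def LogMeanShortRel : Prop :=
  ∃ C : ℝ, ForAllLarge fun D _ χ => AssumptionA D χ → ∀ j ∈ ({1, 2, 3} : Finset ℕ), ∀ d r : ℕ,
    1 ≤ d → 1 ≤ r → ((d * r : ℕ) : ℝ) < bigP D / bigT D ^ 2 → ∀ x : ℝ, 1 ≤ x → x ≤ bigT D →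
      ‖∑ n ∈ Finset.Ioc 0 ⌊x⌋₊, χ (n : ZMod D) * xiZero c' D j n d r / (n : ℂ) *
          (Real.log (x / n) : ℂ)‖ ≤
        C * ell D ^ 2 * (∏ q ∈ (d * r).primeFactors, (1 - (q : ℝ)⁻¹)⁻¹) ^ 2

/-- **(10.8), relative reading** (p. 55, tex L2794): for `dr ≤ P^{0.5}/T`,
`‖𝔳₂ⱼ(d,r) − (L′(1,χ)Π(d,r)/500)β_{j+1}β_{j+2}log P‖ ≤ C𝓛⁻¹⁵(∏_{q∣dr}(1 − q⁻¹)⁻¹)²` — the typed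
`Typed.Sec10A.Eq108` with the factor of row G-d43-1; VERBATIM the conclusion of
`Lemma102.eq108Rel_of_logMean` (= clause 1 of `Skeleton.Lemma102Rel`). CLAIM (reading).
[cite: Zhang2022LandauSiegel, §10 (10.8) p.55] -/
def Eq108Rel : Prop :=
  ∃ C : ℝ, ForAllLarge fun D _ χ => AssumptionA D χ →
    ∀ j ∈ ({1, 2, 3} : Finset ℕ), ∀ d r : ℕ, 1 ≤ d → 1 ≤ r →
      ((d * r : ℕ) : ℝ) ≤ bigP D ^ (0.5 : ℝ) / bigT D →
        ‖frakv2 c' χ j d r - deriv χ.LFunction 1 * PiW χ d r / 500 *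
          (betaJ c' D (j + 1) * betaJ c' D (j + 2)) * Real.log (bigP D)‖ ≤
          C * (ell D ^ 15)⁻¹ * (∏ q ∈ (d * r).primeFactors, (1 - (q : ℝ)⁻¹)⁻¹) ^ 2

/-- **(10.9), relative reading** (p. 55, tex L2798): for `P^{0.5} < dr ≤ P^{0.502}/T`,
`‖𝔳₂ⱼ(d,r) − (500L′(1,χ)Π(d,r)/log P)(−1 + 𝔶₁ⱼ(dr))‖ ≤ C𝓛⁻¹⁵(∏_{q∣dr}(1 − q⁻¹)⁻¹)²`; VERBATIM the
conclusion of `Lemma102.eq109Rel_of_logMean` (= clause 2 of `Skeleton.Lemma102Rel`). CLAIM (reading).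
[cite: Zhang2022LandauSiegel, §10 (10.9) p.55] -/
def Eq109Rel : Prop :=
  ∃ C : ℝ, ForAllLarge fun D _ χ => AssumptionA D χ →
    ∀ j ∈ ({1, 2, 3} : Finset ℕ), ∀ d r : ℕ, 1 ≤ d → 1 ≤ r →
      bigP D ^ (0.5 : ℝ) < ((d * r : ℕ) : ℝ) → ((d * r : ℕ) : ℝ) ≤ bigP D ^ (0.502 : ℝ) / bigT D →
        ‖frakv2 c' χ j d r - 500 * deriv χ.LFunction 1 * PiW χ d r / Real.log (bigP D) *
          (-1 + fraky1 c' D j ((d * r : ℕ) : ℝ))‖ ≤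
          C * (ell D ^ 15)⁻¹ * (∏ q ∈ (d * r).primeFactors, (1 - (q : ℝ)⁻¹)⁻¹) ^ 2

/-- **(10.10), relative reading** (p. 55, tex L2806): for `P^{0.502} < dr ≤ P^{0.504}/T`,
`‖𝔳₂ⱼ(d,r) − (500L′(1,χ)Π(d,r)/log P)(1 + 𝔶₂ⱼ(dr))‖ ≤ C𝓛⁻¹⁵(∏_{q∣dr}(1 − q⁻¹)⁻¹)²`; VERBATIM the
conclusion of `Lemma102.eq1010Rel_of_logMean` (= clause 3 of `Skeleton.Lemma102Rel`). CLAIM (reading).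
[cite: Zhang2022LandauSiegel, §10 (10.10) p.55] -/
def Eq1010Rel : Prop :=
  ∃ C : ℝ, ForAllLarge fun D _ χ => AssumptionA D χ →
    ∀ j ∈ ({1, 2, 3} : Finset ℕ), ∀ d r : ℕ, 1 ≤ d → 1 ≤ r →
      bigP D ^ (0.502 : ℝ) < ((d * r : ℕ) : ℝ) →
        ((d * r : ℕ) : ℝ) ≤ bigP D ^ (0.504 : ℝ) / bigT D →
        ‖frakv2 c' χ j d r - 500 * deriv χ.LFunction 1 * PiW χ d r / Real.log (bigP D) *
          (1 + fraky2 c' D j ((d * r : ℕ) : ℝ))‖ ≤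
          C * (ell D ^ 15)⁻¹ * (∏ q ∈ (d * r).primeFactors, (1 - (q : ℝ)⁻¹)⁻¹) ^ 2

/-- **(10.11), `Π`-weighted reading** (p. 55, tex L2817; row G-d60-1): "if
`dr ∈ (P^{0.5}/T, P^{0.5}] ∪ (P^{0.502}/T, P^{0.502}] ∪ (P^{0.504}/T, P^{0.504})` then `𝔳₂ⱼ(d,r) ≪ 𝓛⁻⁷`"
read with the factor `R(d,r) = (∏_{q∣dr}(1 − q⁻¹)⁻¹)²` (on a window the displayed evaluation has main
term `(500L′(1,χ)Π(d,r)/log P)·O(1) ≍ |Π(d,r)|𝓛⁻⁷`, `|Π(d,r)| ≤ R(d,r)` — cf. the tree edge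
`Typed.Sec10A.eq1011_mid_weak_of_step10u021`). Same shape as `Typed.Sec10A.Eq1011` (range =
`Typed.Sec10A.edgeWindows D` at `y = dr`). On each window the tent decomposition has one short mean
(`X < T`): the claim follows from `LogMean0Rel ∧ LogMeanShortRel` (bookkeeping, not done here).
CLAIM (reading). [cite: Zhang2022LandauSiegel, §10 (10.11) p.55] -/
def Eq1011RelW : Prop :=
  ∃ C : ℝ, ForAllLarge fun D _ χ => AssumptionA D χ →
    ∀ j ∈ ({1, 2, 3} : Finset ℕ), ∀ d r : ℕ, 1 ≤ d → 1 ≤ r →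
      ((d * r : ℕ) : ℝ) ∈ Sec10A.edgeWindows D →
        ‖frakv2 c' χ j d r‖ ≤
          C * (ell D ^ 7)⁻¹ * (∏ q ∈ (d * r).primeFactors, (1 - (q : ℝ)⁻¹)⁻¹) ^ 2

/-- **Lemma 10.2 in the reading the printed proof delivers** (§10 pp. 55–56): the four ranges
(10.8)–(10.11) for `𝔳₂ⱼ(d,r)` with ONE uniform constant — `Skeleton.Lemma102Rel` (p417175) VERBATIM
except that the window clause (10.11) also carries the factor `(∏_{q∣dr}(1 − q⁻¹)⁻¹)²` (rows
G-d43-1 + G-d60-1 together). `↔ Eq108Rel ∧ Eq109Rel ∧ Eq1010Rel ∧ Eq1011RelW`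
(`lemma102RelW_iff_eqs`); implied by `Skeleton.Lemma102Rel` and by the printed `Skeleton.Lemma102`.
CLAIM (reading), stated not asserted. [cite: Zhang2022LandauSiegel, §10 Lemma 10.2 p.55] -/
def Lemma102RelW : Prop :=
  ∃ C : ℝ, ForAllLarge fun D _ χ => AssumptionA D χ →
    ∀ j ∈ ({1, 2, 3} : Finset ℕ), ∀ d r : ℕ, 1 ≤ d → 1 ≤ r →
      (((d * r : ℕ) : ℝ) ≤ bigP D ^ (0.5 : ℝ) / bigT D →
        ‖frakv2 c' χ j d r - deriv χ.LFunction 1 * PiW χ d r / 500 *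
          (betaJ c' D (j + 1) * betaJ c' D (j + 2)) * Real.log (bigP D)‖ ≤
            C * (ell D ^ 15)⁻¹ * (∏ q ∈ (d * r).primeFactors, (1 - (q : ℝ)⁻¹)⁻¹) ^ 2) ∧
      (bigP D ^ (0.5 : ℝ) < ((d * r : ℕ) : ℝ) → ((d * r : ℕ) : ℝ) ≤ bigP D ^ (0.502 : ℝ) / bigT D →
        ‖frakv2 c' χ j d r - 500 * deriv χ.LFunction 1 * PiW χ d r / Real.log (bigP D) *
          (-1 + fraky1 c' D j ((d * r : ℕ) : ℝ))‖ ≤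
            C * (ell D ^ 15)⁻¹ * (∏ q ∈ (d * r).primeFactors, (1 - (q : ℝ)⁻¹)⁻¹) ^ 2) ∧
      (bigP D ^ (0.502 : ℝ) < ((d * r : ℕ) : ℝ) →
        ((d * r : ℕ) : ℝ) ≤ bigP D ^ (0.504 : ℝ) / bigT D →
        ‖frakv2 c' χ j d r - 500 * deriv χ.LFunction 1 * PiW χ d r / Real.log (bigP D) *
          (1 + fraky2 c' D j ((d * r : ℕ) : ℝ))‖ ≤
            C * (ell D ^ 15)⁻¹ * (∏ q ∈ (d * r).primeFactors, (1 - (q : ℝ)⁻¹)⁻¹) ^ 2) ∧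
      ((bigP D ^ (0.5 : ℝ) / bigT D < ((d * r : ℕ) : ℝ) ∧ ((d * r : ℕ) : ℝ) ≤ bigP D ^ (0.5 : ℝ)) ∨
          (bigP D ^ (0.502 : ℝ) / bigT D < ((d * r : ℕ) : ℝ) ∧
            ((d * r : ℕ) : ℝ) ≤ bigP D ^ (0.502 : ℝ)) ∨
          (bigP D ^ (0.504 : ℝ) / bigT D < ((d * r : ℕ) : ℝ) ∧
            ((d * r : ℕ) : ℝ) < bigP D ^ (0.504 : ℝ)) →
        ‖frakv2 c' χ j d r‖ ≤
          C * (ell D ^ 7)⁻¹ * (∏ q ∈ (d * r).primeFactors, (1 - (q : ℝ)⁻¹)⁻¹) ^ 2)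

/-- **The shifted Lemma 10.2 of p. 57, relative reading** (§10.u032–u033, tex L2887–L2891: "with
simple modification, Lemma 10.1 and 10.2 apply to" the sums with `f̃(log(drn)/log P + 0.004 − α̃)`):
`Typed.Sec10B.Lemma102S` (the SUBSTITUTION reading `y* = drP^{0.004}/(Dt₀)`, objects
`Typed.Sec10B.frakv2S`, `Typed.Sec10B.yShift`) VERBATIM except that every right-hand side carries the
factor `(∏_{q∣dr}(1 − q⁻¹)⁻¹)²` (the same contour argument as Lemma 10.2, rows G-d43-1/G-d60-1).
Consumers: `Typed.Sec10C.Low1214Eval / Mid1214Eval / Top1214Eval` («By a result similar to Lemma 10.2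
…», p. 60–61). CLAIM (reading), stated not asserted. [cite: Zhang2022LandauSiegel, §10 p.57, tex L2887] -/
def Lemma102SRel : Prop :=
  ∃ C : ℝ, ForAllLarge fun D _ χ => AssumptionA D χ →
    ∀ j ∈ ({1, 2, 3} : Finset ℕ), ∀ d r : ℕ, 1 ≤ d → 1 ≤ r →
      (yShift D ((d * r : ℕ) : ℝ) ≤ bigP D ^ (0.5 : ℝ) / bigT D →
        ‖frakv2S c' χ j d r - deriv χ.LFunction 1 * PiW χ d r / 500 *
          (betaJ c' D (j + 1) * betaJ c' D (j + 2)) * Real.log (bigP D)‖ ≤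
            C * (ell D ^ 15)⁻¹ * (∏ q ∈ (d * r).primeFactors, (1 - (q : ℝ)⁻¹)⁻¹) ^ 2) ∧
      (bigP D ^ (0.5 : ℝ) < yShift D ((d * r : ℕ) : ℝ) →
        yShift D ((d * r : ℕ) : ℝ) ≤ bigP D ^ (0.502 : ℝ) / bigT D →
        ‖frakv2S c' χ j d r - 500 * deriv χ.LFunction 1 * PiW χ d r / Real.log (bigP D) *
          (-1 + fraky1 c' D j (yShift D ((d * r : ℕ) : ℝ)))‖ ≤
            C * (ell D ^ 15)⁻¹ * (∏ q ∈ (d * r).primeFactors, (1 - (q : ℝ)⁻¹)⁻¹) ^ 2) ∧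
      (bigP D ^ (0.502 : ℝ) < yShift D ((d * r : ℕ) : ℝ) →
        yShift D ((d * r : ℕ) : ℝ) ≤ bigP D ^ (0.504 : ℝ) / bigT D →
        ‖frakv2S c' χ j d r - 500 * deriv χ.LFunction 1 * PiW χ d r / Real.log (bigP D) *
          (1 + fraky2 c' D j (yShift D ((d * r : ℕ) : ℝ)))‖ ≤
            C * (ell D ^ 15)⁻¹ * (∏ q ∈ (d * r).primeFactors, (1 - (q : ℝ)⁻¹)⁻¹) ^ 2) ∧
      ((bigP D ^ (0.5 : ℝ) / bigT D < yShift D ((d * r : ℕ) : ℝ) ∧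
            yShift D ((d * r : ℕ) : ℝ) ≤ bigP D ^ (0.5 : ℝ)) ∨
          (bigP D ^ (0.502 : ℝ) / bigT D < yShift D ((d * r : ℕ) : ℝ) ∧
            yShift D ((d * r : ℕ) : ℝ) ≤ bigP D ^ (0.502 : ℝ)) ∨
          (bigP D ^ (0.504 : ℝ) / bigT D < yShift D ((d * r : ℕ) : ℝ) ∧
            yShift D ((d * r : ℕ) : ℝ) < bigP D ^ (0.504 : ℝ)) →
        ‖frakv2S c' χ j d r‖ ≤
          C * (ell D ^ 7)⁻¹ * (∏ q ∈ (d * r).primeFactors, (1 - (q : ℝ)⁻¹)⁻¹) ^ 2)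

/-- **§18 pp. 100–101, the bound for (18.3), from Lemma 10.1 and Lemma 10.2 in the reading
`Lemma102RelW`** — the banked consumer node `Skeleton.Ded183` (`Eq183 → Prop71 → Lemma101 → Lemma102 →
Bound183`, kernel theorem `Typed.Section18.ded183_holds`) re-pointed to `Lemma102RelW` (cf.
`Skeleton.Ded183Rel`, input `Skeleton.Lemma102Rel`). CLAIM (deduction node), stated not asserted.
[cite: Zhang2022LandauSiegel, §18 pp.100–101, (18.3)] -/
def Ded183RelW : Prop := Eq183 c' → Prop71 c' → Lemma101 c' → Lemma102RelW c' → Bound183 c'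

end Statements

/-! ## Bookkeeping edges (no analytic content) -/

section Edges

variable {c' : ℝ}

/-- `(𝓛ᵏ)⁻¹ ≥ 0`. [folklore] -/
private theorem ell_pow_inv_nonneg (D k : ℕ) : 0 ≤ (ell D ^ k)⁻¹ :=
  inv_nonneg.mpr (pow_nonneg (Real.log_natCast_nonneg D) k)

/-- `R(d,r) = (∏_{q∣dr}(1 − q⁻¹)⁻¹)² ≥ 1`. [folklore] -/
private theorem one_le_relFactor (n : ℕ) :
    1 ≤ (∏ q ∈ n.primeFactors, (1 - (q : ℝ)⁻¹)⁻¹) ^ 2 := by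
  have hprod : 1 ≤ ∏ q ∈ n.primeFactors, (1 - (q : ℝ)⁻¹)⁻¹ := by
    refine le_of_eq_of_le (Finset.prod_const_one (s := n.primeFactors)).symm
      (Finset.prod_le_prod (fun _ _ => zero_le_one) fun q hq => ?_)
    have hq2 : (2 : ℝ) ≤ q := by exact_mod_cast (Nat.prime_of_mem_primeFactors hq).two_le
    have h1 : 0 < 1 - (q : ℝ)⁻¹ := by
      have : (q : ℝ)⁻¹ ≤ 1 / 2 := by rw [inv_eq_one_div]; gcongr
      linarith
    have h2 : 1 - (q : ℝ)⁻¹ ≤ 1 := by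
      have : 0 ≤ (q : ℝ)⁻¹ := by positivity
      linarith
    exact (one_le_inv₀ h1).mpr h2
  nlinarith

/-- `R(d,r) ≥ 0`. [folklore] -/
private theorem relFactor_nonneg (n : ℕ) :
    0 ≤ (∏ q ∈ n.primeFactors, (1 - (q : ℝ)⁻¹)⁻¹) ^ 2 :=
  zero_le_one.trans (one_le_relFactor n)

/-- Enlarging the constant in a bound `t ≤ C·a·R` (`a, R ≥ 0`). [folklore] -/
private theorem lift_const {C C' a R t : ℝ} (ht : t ≤ C * a * R) (hC : C ≤ C') (ha : 0 ≤ a)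
    (hR : 0 ≤ R) : t ≤ C' * a * R :=
  ht.trans (mul_le_mul_of_nonneg_right (mul_le_mul_of_nonneg_right hC ha) hR)

/-- Enlarging the constant and inserting a factor `R ≥ 1` in a bound `t ≤ C·a` (`a ≥ 0`, `C′ ≥ 0`).
[folklore] -/
private theorem lift_const_one {C C' a R t : ℝ} (ht : t ≤ C * a) (hC : C ≤ C') (hC' : 0 ≤ C')
    (ha : 0 ≤ a) (hR : 1 ≤ R) : t ≤ C' * a * R :=
  calc t ≤ C * a := ht
    _ ≤ C' * a := mul_le_mul_of_nonneg_right hC ha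
    _ = C' * a * 1 := (mul_one _).symm
    _ ≤ C' * a * R := mul_le_mul_of_nonneg_left hR (mul_nonneg hC' ha)

/-- `|Π(d,r)| ≤ (∏_{q∣dr}(1 − q⁻¹)⁻¹)²` for `d, r ≥ 1` (the tree's `Skeleton.norm_PiW_le`, with
`dr/φ(dr) = ∏_{q∣dr}(1 − q⁻¹)⁻¹`). [cite: Zhang2022LandauSiegel, §8 Lemma 8.3 p.46] -/
theorem norm_PiW_le_relFactor {D : ℕ} (χ : DirichletCharacter ℂ D) {d r : ℕ} (hd : 1 ≤ d)
    (hr : 1 ≤ r) : ‖PiW χ d r‖ ≤ (∏ q ∈ (d * r).primeFactors, (1 - (q : ℝ)⁻¹)⁻¹) ^ 2 := by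
  have hd0 : d ≠ 0 := by omega
  have hr0 : r ≠ 0 := by omega
  have h := norm_PiW_le χ hd0 hr0
  rw [self_div_totient_eq_prod (mul_ne_zero hd0 hr0)] at h
  refine h.trans (le_of_eq ?_)
  congr 1
  refine Finset.prod_congr rfl fun q hq => ?_
  have hq : (1 : ℝ) < q := by exact_mod_cast (Nat.prime_of_mem_primeFactors hq).one_lt
  have hq0 : (q : ℝ) ≠ 0 := by linarith
  have hq1 : (q : ℝ) - 1 ≠ 0 := by linarith
  field_simp

/-- **(10.8) relative ⇐ the shift-0 log-mean** — `Lemma102.eq108Rel_of_logMean` with its hypothesis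
named. [cite: Zhang2022LandauSiegel, §10 (10.8) p.55] -/
theorem eq108Rel_of_logMean0Rel (h : LogMean0Rel c') : Eq108Rel c' :=
  Lemma102.eq108Rel_of_logMean h

/-- **(10.9) relative ⇐ the shift-0 log-mean** — `Lemma102.eq109Rel_of_logMean` with its hypothesis
named. [cite: Zhang2022LandauSiegel, §10 (10.9) p.55] -/
theorem eq109Rel_of_logMean0Rel (h : LogMean0Rel c') : Eq109Rel c' :=
  Lemma102.eq109Rel_of_logMean h

/-- **(10.10) relative ⇐ the shift-0 log-mean** — `Lemma102.eq1010Rel_of_logMean` with its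
hypothesis named. [cite: Zhang2022LandauSiegel, §10 (10.10) p.55] -/
theorem eq1010Rel_of_logMean0Rel (h : LogMean0Rel c') : Eq1010Rel c' :=
  Lemma102.eq1010Rel_of_logMean h

/-- **`Lemma102RelW` ⇔ its four displays** `Eq108Rel ∧ Eq109Rel ∧ Eq1010Rel ∧ Eq1011RelW` (merge /
split the uniform constant; cf. `Typed.Sec10A.lemma102_iff_eqs`). [cite: Zhang2022LandauSiegel, §10 Lemma 10.2 p.55] -/
theorem lemma102RelW_iff_eqs :
    Lemma102RelW c' ↔ Eq108Rel c' ∧ Eq109Rel c' ∧ Eq1010Rel c' ∧ Eq1011RelW c' := by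
  constructor
  · rintro ⟨C, hF⟩
    refine ⟨⟨C, hF.mono fun D _ χ _ _ h hA j hj d r hd hr => (h hA j hj d r hd hr).1⟩,
      ⟨C, hF.mono fun D _ χ _ _ h hA j hj d r hd hr => (h hA j hj d r hd hr).2.1⟩,
      ⟨C, hF.mono fun D _ χ _ _ h hA j hj d r hd hr => (h hA j hj d r hd hr).2.2.1⟩,
      ⟨C, hF.mono fun D _ χ _ _ h hA j hj d r hd hr hy => (h hA j hj d r hd hr).2.2.2 ?_⟩⟩
    exact (Sec10A.mem_edgeWindows_iff D _).mp hy
  · rintro ⟨⟨C₂, h₂⟩, ⟨C₃, h₃⟩, ⟨C₄, h₄⟩, ⟨C₅, h₅⟩⟩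
    refine ⟨max (max C₂ C₃) (max C₄ C₅), ((h₂.and h₃).and (h₄.and h₅)).mono ?_⟩
    intro D _ χ _ _ h hA j hj d r hd hr
    obtain ⟨⟨k₂, k₃⟩, k₄, k₅⟩ := h
    have h15 := ell_pow_inv_nonneg D 15
    have h7 := ell_pow_inv_nonneg D 7
    have hR := relFactor_nonneg (d * r)
    exact ⟨fun hy => lift_const (k₂ hA j hj d r hd hr hy) ((le_max_left _ _).trans (le_max_left _ _))
        h15 hR,
      fun hy1 hy2 => lift_const (k₃ hA j hj d r hd hr hy1 hy2)
        ((le_max_right _ _).trans (le_max_left _ _)) h15 hR,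
      fun hy1 hy2 => lift_const (k₄ hA j hj d r hd hr hy1 hy2)
        ((le_max_left _ _).trans (le_max_right _ _)) h15 hR,
      fun hy => lift_const (k₅ hA j hj d r hd hr ((Sec10A.mem_edgeWindows_iff D _).mpr hy))
        ((le_max_right _ _).trans (le_max_right _ _)) h7 hR⟩

/-- **ASSEMBLY of Lemma 10.2 in the delivered reading**: the shift-0 log-mean estimate and the
`Π`-weighted window bound give `Lemma102RelW` ((10.8)–(10.10) by the tree's tent decomposition and
residue combinations, `Section10Lemma102Steps`). [cite: Zhang2022LandauSiegel, §10 Lemma 10.2 pp.55–56] -/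
theorem lemma102RelW_of_logMean0Rel (hA : LogMean0Rel c') (h11 : Eq1011RelW c') :
    Lemma102RelW c' :=
  lemma102RelW_iff_eqs.mpr ⟨eq108Rel_of_logMean0Rel hA, eq109Rel_of_logMean0Rel hA,
    eq1010Rel_of_logMean0Rel hA, h11⟩

/-- The printed uniform (10.11) implies the `Π`-weighted reading (`R(d,r) ≥ 1`).
[cite: Zhang2022LandauSiegel, §10 (10.11) p.55] -/
theorem eq1011RelW_of_eq1011 (h : Sec10A.Eq1011 c') : Eq1011RelW c' := by
  obtain ⟨C, hC⟩ := h
  refine ⟨|C|, hC.mono fun D _ χ _ _ hS hA j hj d r hd hr hy => ?_⟩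
  exact lift_const_one (hS hA j hj d r hd hr hy) (le_abs_self C) (abs_nonneg C)
    (ell_pow_inv_nonneg D 7) (one_le_relFactor _)

/-- The `(1 + |Π(d,r)|)`-weighted window bound (the shape of the tree edge
`Typed.Sec10A.eq1011_mid_weak_of_step10u021`, here on all three windows) implies `Eq1011RelW`, since
`1 + |Π(d,r)| ≤ 2(∏_{q∣dr}(1 − q⁻¹)⁻¹)²`. [cite: Zhang2022LandauSiegel, §10 (10.11) p.55] -/
theorem eq1011RelW_of_piWeighted
    (h : ∃ C : ℝ, ForAllLarge fun D _ χ => AssumptionA D χ →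
      ∀ j ∈ ({1, 2, 3} : Finset ℕ), ∀ d r : ℕ, 1 ≤ d → 1 ≤ r →
        ((d * r : ℕ) : ℝ) ∈ Sec10A.edgeWindows D →
          ‖frakv2 c' χ j d r‖ ≤ C * (1 + ‖PiW χ d r‖) * (ell D ^ 7)⁻¹) :
    Eq1011RelW c' := by
  obtain ⟨C, hC⟩ := h
  refine ⟨2 * |C|, hC.mono fun D _ χ _ _ hS hA j hj d r hd hr hy => ?_⟩
  have h1 := hS hA j hj d r hd hr hy
  have h7 := ell_pow_inv_nonneg D 7
  set R : ℝ := (∏ q ∈ (d * r).primeFactors, (1 - (q : ℝ)⁻¹)⁻¹) ^ 2 with hR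
  have hR1 : 1 ≤ R := one_le_relFactor _
  have hPi : ‖PiW χ d r‖ ≤ R := norm_PiW_le_relFactor χ hd hr
  have h2 : 1 + ‖PiW χ d r‖ ≤ 2 * R := by linarith
  have h0 : 0 ≤ 1 + ‖PiW χ d r‖ := by positivity
  calc ‖frakv2 c' χ j d r‖ ≤ C * (1 + ‖PiW χ d r‖) * (ell D ^ 7)⁻¹ := h1
    _ ≤ |C| * (1 + ‖PiW χ d r‖) * (ell D ^ 7)⁻¹ := by gcongr; exact le_abs_self C
    _ ≤ |C| * (2 * R) * (ell D ^ 7)⁻¹ := by gcongr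
    _ = 2 * |C| * (ell D ^ 7)⁻¹ * R := by ring

/-- `Skeleton.Lemma102Rel` (clause 4 uniform) implies `Lemma102RelW`. [cite: Zhang2022LandauSiegel, §10 Lemma 10.2 p.55] -/
theorem lemma102RelW_of_lemma102Rel (h : Lemma102Rel c') : Lemma102RelW c' := by
  obtain ⟨C, hC⟩ := h
  refine ⟨|C|, hC.mono fun D _ χ _ _ hS hA j hj d r hd hr => ?_⟩
  obtain ⟨k₁, k₂, k₃, k₄⟩ := hS hA j hj d r hd hr
  have h15 := ell_pow_inv_nonneg D 15
  have h7 := ell_pow_inv_nonneg D 7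
  have hR := relFactor_nonneg (d * r)
  have hCabs : C ≤ |C| := le_abs_self C
  exact ⟨fun hy => lift_const (k₁ hy) hCabs h15 hR, fun hy1 hy2 => lift_const (k₂ hy1 hy2) hCabs h15 hR,
    fun hy1 hy2 => lift_const (k₃ hy1 hy2) hCabs h15 hR,
    fun hy => lift_const_one (k₄ hy) hCabs (abs_nonneg C) h7 (one_le_relFactor _)⟩

/-- The printed Lemma 10.2 implies `Lemma102RelW` (via `Skeleton.lemma102Rel_of_lemma102`).
[cite: Zhang2022LandauSiegel, §10 Lemma 10.2 p.55] -/
theorem lemma102RelW_of_lemma102 (h : Lemma102 c') : Lemma102RelW c' :=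
  lemma102RelW_of_lemma102Rel (lemma102Rel_of_lemma102 h)

/-- The substitution-reading shifted Lemma 10.2 `Typed.Sec10B.Lemma102S` implies its relative reading
(`R(d,r) ≥ 1`). [cite: Zhang2022LandauSiegel, §10 p.57, tex L2887] -/
theorem lemma102SRel_of_lemma102S (h : Lemma102S c') : Lemma102SRel c' := by
  obtain ⟨C, hC⟩ := h
  refine ⟨|C|, hC.mono fun D _ χ _ _ hS hA j hj d r hd hr => ?_⟩
  obtain ⟨k₁, k₂, k₃, k₄⟩ := hS hA j hj d r hd hr
  have hR1 := one_le_relFactor (d * r)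
  have h15 := ell_pow_inv_nonneg D 15
  have h7 := ell_pow_inv_nonneg D 7
  have hCabs : C ≤ |C| := le_abs_self C
  have hC0 : 0 ≤ |C| := abs_nonneg C
  exact ⟨fun hy => lift_const_one (k₁ hy) hCabs hC0 h15 hR1,
    fun hy1 hy2 => lift_const_one (k₂ hy1 hy2) hCabs hC0 h15 hR1,
    fun hy1 hy2 => lift_const_one (k₃ hy1 hy2) hCabs hC0 h15 hR1,
    fun hy => lift_const_one (k₄ hy) hCabs hC0 h7 hR1⟩

/-- `Ded183RelW` (weaker Lemma-10.2 input) implies the banked `Skeleton.Ded183Rel`.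
[cite: Zhang2022LandauSiegel, §18 pp.100–101] -/
theorem ded183Rel_of_ded183RelW (h : Ded183RelW c') : Ded183Rel c' :=
  fun h183 h71 h101 h102 => h h183 h71 h101 (lemma102RelW_of_lemma102Rel h102)

/-- `Ded183RelW` implies the banked `Skeleton.Ded183`. [cite: Zhang2022LandauSiegel, §18 pp.100–101] -/
theorem ded183_of_ded183RelW (h : Ded183RelW c') : Ded183 c' :=
  fun h183 h71 h101 h102 => h h183 h71 h101 (lemma102RelW_of_lemma102 h102)

end Edges

end Literature.NumberTheory.LFunctions.Zhang2022.Typed.Sec10Rel
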